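import Summits.BirchSwinnertonDyer.Rank1Residual.X5.KummerRelaxedStrictCount
import Summits.BirchSwinnertonDyer.Rank1Residual.Additive.PoitouTateSelmerCountingProduct
import Summits.BirchSwinnertonDyer.Rank1Residual.GaloisImage.LocalEulerPoincareCharacteristicHolds
import Summits.BirchSwinnertonDyer.Rank1Residual.X11b.KummerPoitouTateExact
import HarnessLib

/-!
# The Poitou–Tate product count with an IDLE dual side: `[H¹_𝓖 : Sel^{(p^m)}] = ∏_{w ∈ T} [𝓖_w : 𝓚_w]`
# for a structure `𝓖 ⊇ 𝓚` enlarging the Kummer structure at a finite set `T` where every Kummer-Selmer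
# class is locally trivial (cell `bsd-potss`, seat `bsd-potss-ctrl` g2; R-ctrl-17 = K8 crux
# `ExactControlEven` on the `p ∣ Tam` rows, brick 1 — the rank-ZERO Cassels–Poitou–Tate count, in
# which the dual side vanishes because global classes are divisible enough at large level)

HONEST FRAMING (cell `bsd-potss`, run/shared/lean/pub/bsd-potss/; FULL-BSD rank ≤ 1 programme,
tranche 1b): TOOL THEOREM ONLY — no definition, no named Literature fact introduced (the ONE fact-shaped
input is the tree's `poitouTate_selmerStructure_duality_real K`, hypothesis `hPT`, exactly as x1b's
files 63 / 107; Tate's local Euler characteristic and the Weil pairing are tree THEOREMS), no `sorry`,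
axioms standard; nothing is booked; no label / mark / count moves; nothing about (C1_η) or `BSD(W, p)`
is claimed.

## What
For a number field `K`, an elliptic `E/K`, a prime power `p^m` (`m ≥ 1`), a finite set `T` of finite
places, and a Selmer structure `𝓖` on `E[p^m]` with `𝓖_w ⊇ 𝓚_w` at `w ∈ T` and `𝓖_v = 𝓚_v` elsewhere
(`𝓚` the Kummer structure): IF every class of `Sel^{(p^m)}(E/K) = H¹_𝓚` localises to `0` at every
`w ∈ T` (`hloc0` — in RANK ZERO with `E(K)[p] = 0` this holds once `p^{m−e}` kills `E(K_w)[p^∞]`,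
`p^e = #Sel_{p^∞}(E/K)`: x1b file 64 `KummerLevelStabilisation.localization_eq_zero_of_nsmul_eq_zero`),
THEN **`[H¹_𝓖 : H¹_𝓚] = ∏_{w ∈ T} [𝓖_w : 𝓚_w]`** (`relIndex_kummer_eq_prod_of_localization_eq_zero`).
Proof: x1b file 58 `relIndex_selmerGroup_eq_prod_iff_dual` (the product form of Howard's Thm. 2.1.11)
reduces the claim to `H¹_{𝓚^*}(K, E[p^m]^D) = H¹_{𝓖^*}(K, E[p^m]^D)`; by X5's Weil transport
(`dualSelmerGroup_eq_map_selmerGroup_dualTransported`) and the residual SELF-DUALITY of `𝓚`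
(`dualTransported_kummerSelmerStructure_eq`: Tate's local Euler characteristic + the real places)
`H¹_{𝓚^*} = w_*(H¹_𝓚)` and `H¹_{𝓖^*} = w_*(H¹_{w⁻¹𝓖^*})`, and `H¹_𝓚 ⊆ H¹_{w⁻¹𝓖^*}`: off `T` the
conditions agree, at `w ∈ T` the localisation is `0`. The exceptional set `S ⊇ ∞ ∪ {v ∣ p} ∪ bad ∪ T`
and the Weil pairing are produced inside (X11b `exists_exceptional_finset`, tree `exists_weilPairing_holds`),
word for word X5's `relIndex_kummer_update_bot_update_top_eq`.

References: [Howard2004HeegnerKolyvagin] Thm. 2.1.11; [MilneADT2006] I Thm. 2.8, Cor. 3.4, Thm. 4.10;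
[Sakamoto2024] §3.1.2, Def. 3.9; [GreenbergLNM1716] §4 (pp. 98–103); [SilvermanAEC2009] Prop. III.8.1.
-/

noncomputable section

open scoped Classical

open CategoryTheory Field Function NumberField IsDedekindDomain WeierstrassCurve
open Literature.NumberTheory.EllipticCurves
open Literature.NumberTheory.GaloisRepresentations
open Literature.NumberTheory.GaloisRepresentations.DiscreteGaloisModule (SelmerStructure)
open Literature.NumberTheory.GaloisCohomology
open Summit.BirchSwinnertonDyer.Rank1Residual.X5.SelfDualCount
open Summit.BirchSwinnertonDyer.Rank1Residual.GaloisImage.CoreRankZero (selmerGroup_mono)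
open Summit.BirchSwinnertonDyer.Rank1Residual.Additive.PoitouTateCountingProduct
open scoped ContRepresentation

namespace Summit.BirchSwinnertonDyer.Rank1Residual.Additive.RankZeroCount

variable {K : Type} [Field K] [NumberField K] (W : WeierstrassCurve K) [W.IsElliptic]
  (p : ℕ) [hp : Fact p.Prime] (m : ℕ)

/-- **The Poitou–Tate product count with an idle dual side.** See the module docstring.
[cite: Howard2004HeegnerKolyvagin, Thm. 2.1.11 (arXiv:1202.6340 p. 6)] [cite: MilneADT2006, I Thm. 4.10, Cor. 3.4, Thm. 2.8]
[cite: Sakamoto2024, §3.1.2 and Def. 3.9 (p. 924)] [cite: GreenbergLNM1716, §4 (pp. 98–103)] -/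
theorem relIndex_kummer_eq_prod_of_localization_eq_zero (hm : 1 ≤ m)
    (hPT : poitouTate_selmerStructure_duality_real K)
    (T : Finset (HeightOneSpectrum (𝓞 K)))
    (𝓖 : SelmerStructure (W.torsionGaloisModule ((p ^ m : ℕ) : ℤ)))
    (h𝓖T : ∀ w ∈ T, W.kummerSelmerStructure ((p ^ m : ℕ) : ℤ) (Sum.inr w) ≤ 𝓖 (Sum.inr w))
    (h𝓖off : ∀ v : Place K, (∀ w ∈ T, v ≠ Sum.inr w) →
      𝓖 v = W.kummerSelmerStructure ((p ^ m : ℕ) : ℤ) v)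
    (hloc0 : ∀ c ∈ (W.kummerSelmerStructure ((p ^ m : ℕ) : ℤ) :
        SelmerStructure (W.torsionGaloisModule ((p ^ m : ℕ) : ℤ))).selmerGroup, ∀ w ∈ T,
      galoisCohomology.localization (W.torsionGaloisModule ((p ^ m : ℕ) : ℤ)) (Sum.inr w) 1 c = 0) :
    (W.kummerSelmerStructure ((p ^ m : ℕ) : ℤ) :
        SelmerStructure (W.torsionGaloisModule ((p ^ m : ℕ) : ℤ))).selmerGroup.relIndex 𝓖.selmerGroup =
      ∏ w ∈ T, (W.kummerSelmerStructure ((p ^ m : ℕ) : ℤ) (Sum.inr w)).relIndex (𝓖 (Sum.inr w)) := by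
  haveI : NeZero (p ^ m) := ⟨pow_ne_zero m hp.out.ne_zero⟩
  have hpm : IsPrimePow (p ^ m) := (isPrimePow_nat_iff (p ^ m)).mpr ⟨p, m, hp.out, hm, rfl⟩
  haveI := finite_geomTorsion_of_neZero W (p ^ m)
  set 𝓚 : SelmerStructure (W.torsionGaloisModule ((p ^ m : ℕ) : ℤ)) :=
    W.kummerSelmerStructure ((p ^ m : ℕ) : ℤ) with h𝓚def
  -- the Poitou–Tate family from `hPT`, Tate's local Euler characteristic (a tree THEOREM), a Weil pairing
  obtain ⟨inv, hperf, hvan, -, hcomp, hreal⟩ := exists_localInvariants_injective_inl_of_real hPT (p ^ m)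
  have hEP : ∀ v : HeightOneSpectrum (𝓞 K), localEulerPoincareCharacteristic (v.adicCompletion K) :=
    fun v ↦ by
      haveI : CharZero (v.adicCompletion K) := charZero_adicCompletion v
      exact localEulerPoincareCharacteristic_holds (v.adicCompletion K)
  obtain ⟨e, hμ, hadd₁, hadd₂, halt, hnondeg, hgal⟩ := exists_weilPairing_holds W (p ^ m)
    (hp.out.two_le.trans (Nat.le_self_pow (by omega) p)) (Nat.cast_ne_zero.mpr (NeZero.ne (p ^ m)))
  -- the exceptional set `S ⊇ T ∪ ∞ ∪ {v ∣ p} ∪ bad`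
  obtain ⟨S, hTS, hinf, hpS, hbad⟩ :=
    X11b.KummerPT.exists_exceptional_finset W p (T.image (fun w ↦ (Sum.inr w : Place K)))
  have hT : ∀ w ∈ T, (Sum.inr w : Place K) ∈ S := fun w hw ↦ hTS (Finset.mem_image_of_mem _ hw)
  have hS : ∀ v : HeightOneSpectrum (𝓞 K), (Sum.inr v : Place K) ∉ S →
      (((p ^ m : ℕ) : ℕ) : 𝓞 K) ∉ v.asIdeal ∧
        GaloisRep.IsUnramifiedAt v (W.torsionGaloisModule ((p ^ m : ℕ) : ℤ)) := fun v hv ↦ by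
    have hpv : ((p : ℕ) : 𝓞 K) ∉ v.asIdeal := fun h ↦ hv (hpS v h)
    have hgood : W.HasGoodReductionAt v := by_contra fun h ↦ hv (hbad v h)
    have hpkv : ((p ^ m : ℕ) : 𝓞 K) ∉ v.asIdeal := by
      rw [Nat.cast_pow]
      exact fun h ↦ hpv (v.isPrime.mem_of_pow_mem m h)
    exact ⟨hpkv, X11b.AcSelmer.isUnramifiedAt_torsionGaloisModule W hgood
      (by rw [Int.cast_natCast]; exact hpkv)⟩
  have h𝓚 : SelmerStructure.IsUnramifiedOutside 𝓚 S :=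
    X11b.KummerDuality.kummerSelmerStructure_isUnramifiedOutside W p m S hinf hpS hbad
  -- `𝓚 ≤ 𝓖`, `𝓖` unramified outside `S`, they agree off `T`
  have hmemT : ∀ v : Place K, (¬ ∃ w ∈ T, v = Sum.inr w) → ∀ w ∈ T, v ≠ Sum.inr w :=
    fun v hv w hw h ↦ hv ⟨w, hw, h⟩
  have hle : 𝓚 ≤ 𝓖 := fun v ↦ by
    by_cases hv : ∃ w ∈ T, v = Sum.inr w
    · obtain ⟨w, hw, rfl⟩ := hv
      exact h𝓖T w hw
    · rw [h𝓖off v (hmemT v hv)]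
  have hdiff : ∀ v : Place K, (∀ w ∈ T, v ≠ Sum.inr w) → 𝓚 v = 𝓖 v := fun v hv ↦ (h𝓖off v hv).symm
  have h𝓖S : 𝓖.IsUnramifiedOutside S := by
    refine ⟨h𝓚.1, fun v hv ↦ ?_⟩
    rw [h𝓖off (Sum.inr v) (fun w hw h ↦ hv (h ▸ hT w hw))]
    exact h𝓚.2 v hv
  have hM : ∀ P : geomTorsion W ((p ^ m : ℕ) : ℤ), (p ^ m) • P = 0 := fun P ↦ AddSubgroup.torsionBy.nsmul P
  -- the local indices are positive (local `H¹` is finite)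
  have hpos : ∏ w ∈ T, (𝓚 (Sum.inr w)).relIndex (𝓖 (Sum.inr w)) ≠ 0 := by
    refine Finset.prod_ne_zero_iff.mpr fun w _ ↦ ?_
    haveI := X11b.KummerPT.finite_galoisCohomology_toLocal_inr W (p ^ m) w
    rw [AddSubgroup.relIndex]
    exact AddSubgroup.FiniteIndex.index_ne_zero
  -- residual self-duality of `𝓚`
  have hsd : inv.dualTransported 𝓚 (weilDualIntertwining W (p ^ m) e hμ hadd₁ hadd₂ hgal) = 𝓚 :=
    funext fun v ↦ dualTransported_kummerSelmerStructure_eq W (p ^ m) e hμ hadd₁ hadd₂ hgal halt hnondeg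
      inv hpm hperf hEP hreal v
  refine (relIndex_selmerGroup_eq_prod_iff_dual hperf hvan hcomp hM hS T hT hle h𝓖S hdiff hpos).mpr ?_
  -- the dual Selmer groups agree: `H¹_{𝓚^*} ⊆ H¹_{𝓖^*}` by the Weil transport and `hloc0`
  refine le_antisymm ?_ (selmerGroup_mono (inv.dualSelmerStructure_anti _ hle))
  intro y hy
  rw [dualSelmerGroup_eq_map_selmerGroup_dualTransported W (p ^ m) e hμ hadd₁ hadd₂ hgal hnondeg inv 𝓚,
    hsd] at hy
  obtain ⟨x, hx, rfl⟩ := hy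
  rw [dualSelmerGroup_eq_map_selmerGroup_dualTransported W (p ^ m) e hμ hadd₁ hadd₂ hgal hnondeg inv 𝓖]
  refine ⟨x, ?_, rfl⟩
  have hx' := (SelmerStructure.mem_selmerGroup_iff _ _).mp hx
  rw [SetLike.mem_coe, SelmerStructure.mem_selmerGroup_iff]
  intro v
  by_cases hv : ∃ w ∈ T, v = Sum.inr w
  · obtain ⟨w, hw, rfl⟩ := hv
    rw [hloc0 x hx w hw]
    exact zero_mem _
  · have heq : inv.dualTransported 𝓖 (weilDualIntertwining W (p ^ m) e hμ hadd₁ hadd₂ hgal) v =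
        inv.dualTransported 𝓚 (weilDualIntertwining W (p ^ m) e hμ hadd₁ hadd₂ hgal) v := by
      ext z
      rw [LocalInvariants.mem_dualTransported_iff, LocalInvariants.mem_dualTransported_iff,
        LocalInvariants.dualSelmerStructure_apply, LocalInvariants.dualSelmerStructure_apply,
        h𝓖off v (hmemT v hv)]
    rw [heq, hsd]
    exact hx' v

end Summit.BirchSwinnertonDyer.Rank1Residual.Additive.RankZeroCount

end
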